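import Summits.MatrixMultiplication.MatrixMultiplication.Theorems.SoloInformedValVertexDegree

/-!
# SoloInformedValPairPacking — two vertices of one class carry at most `|G|` triangles

Solo-informed programme (MatrixMultiplication, side question on the value of trapezoid-free triples), gen 77.

Setting (as in `SoloInformedValInducedMatching`, `SoloInformedValVertexDegree`): an abelian group `G`,
potentials `x : I → G`, `y : J → G`, `z : K → G`, pair graphs `H_IJ, H_JK, H_KI`, and the hypothesis
`NoAccidental` (every vanishing sum of an `IJ`-, a `JK`- and a `KI`-difference comes from a triangle).  Write
`t_v` for the number of triangles through a vertex `v`; `SoloInformedValVertexDegree` proved `t_v ≤ |G|`.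

## Results

* `NoAccidental.edgeJK_eq_of_label_eq` — the `JK`-label `y j - z k` of a triangle determines its `JK`-edge.
* `NoAccidental.shifted_label_ne` — if a `JK`-edge `(j, k)` is completed to triangles by two distinct
  `I`-vertices `i₁ ≠ i₂`, then the shifted label `y j - z k + (x i₂ - x i₁)` is not the label of any `JK`-edge.
* `NoAccidental.card_link_add_card_link_le` — PAIR PACKING: for `i₁ ≠ i₂` and finite sets `S₁`, `S₂` of
  triangles through `i₁`, `i₂` respectively, `|S₁| + |S₂| ≤ |G|`; i.e. `t_{i₁} + t_{i₂} ≤ |G|`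
  (`NoAccidental.degree_add_degree_le`).  Two vertices of one class never carry more than `|G|` triangles
  together (tight for a perfect block `U × V × W` with `|U| = 2`); in particular at most one vertex per class
  has more than `|G|/2` triangles.

## Proof

Plain labels inject the triangles of `S₁`, and those triangles of `S₂` whose `JK`-edge is not completed by
`i₁`, into `G`; an `i₂`-triangle whose `JK`-edge IS completed by `i₁` is coded by its shifted label, which is
never a plain label: `(x i₁ - y j) + (y j' - z k') + (z k - x i₂) = 0` with the edges `(i₁, j)`, `(j', k')`,
`(k, i₂)` would be an accidental solution forcing `i₁ = i₂`.  All codes are distinct.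
-/

namespace Summit.MatrixMultiplication.MatrixMultiplication.Theorems.SoloVal

variable {G : Type*} [AddCommGroup G]
variable {I J K : Type*}
variable {x : I → G} {y : J → G} {z : K → G}
variable {HIJ : Finset (I × J)} {HJK : Finset (J × K)} {HKI : Finset (K × I)}

/-- The `JK`-label of a triangle determines its `JK`-edge: triangles `(i, j, k)`, `(i', j', k')` (through
possibly different `I`-vertices) with `y j - z k = y j' - z k'` have `(j, k) = (j', k')`. -/
theorem NoAccidental.edgeJK_eq_of_label_eq (hN : NoAccidental x y z HIJ HJK HKI) {τ τ' : I × J × K}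
    (hτ : IsTriangle HIJ HJK HKI τ) (hτ' : IsTriangle HIJ HJK HKI τ')
    (heq : y τ.2.1 - z τ.2.2 = y τ'.2.1 - z τ'.2.2) : τ.2 = τ'.2 := by
  obtain ⟨i, j, k⟩ := τ
  obtain ⟨i', j', k'⟩ := τ'
  simp only at heq ⊢
  obtain ⟨-, h2, -⟩ := hτ
  obtain ⟨h1', -, h3'⟩ := hτ'
  have hsum : (x i' - y j') + (y j - z k) + (z k' - x i') = 0 := by
    calc (x i' - y j') + (y j - z k) + (z k' - x i') = (y j - z k) - (y j' - z k') := by abel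
      _ = 0 := sub_eq_zero.mpr heq
  obtain ⟨-, hj, hk⟩ := hN i' j' j k k' i' h1' h2 h3' hsum
  rw [hj, hk]

/-- A SHIFTED LABEL IS NOT A LABEL.  If `(i₁, j) ∈ H_IJ` and `(k, i₂) ∈ H_KI` with `i₁ ≠ i₂` (e.g. the `JK`-edge
`(j, k)` is completed by both `i₁` and `i₂`), then `y j - z k + (x i₂ - x i₁)` is not the label of any `JK`-edge. -/
theorem NoAccidental.shifted_label_ne (hN : NoAccidental x y z HIJ HJK HKI) {i₁ i₂ : I} (hne : i₁ ≠ i₂)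
    {j : J} {k : K} (h1 : (i₁, j) ∈ HIJ) (h3 : (k, i₂) ∈ HKI) {j' : J} {k' : K} (h2 : (j', k') ∈ HJK) :
    y j - z k + (x i₂ - x i₁) ≠ y j' - z k' := by
  intro heq
  have hsum : (x i₁ - y j) + (y j' - z k') + (z k - x i₂) = 0 := by
    calc (x i₁ - y j) + (y j' - z k') + (z k - x i₂)
        = (y j' - z k') - (y j - z k + (x i₂ - x i₁)) := by abel
      _ = 0 := sub_eq_zero.mpr heq.symm
  exact hne (hN i₁ j j' k' k i₂ h1 h2 h3 hsum).1

/-- PAIR PACKING: finite sets `S₁`, `S₂` of triangles through two distinct `I`-vertices `i₁ ≠ i₂` satisfy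
`|S₁| + |S₂| ≤ |G|`. -/
theorem NoAccidental.card_link_add_card_link_le [Fintype G] [DecidableEq G] [DecidableEq I] [DecidableEq J]
    [DecidableEq K] (hN : NoAccidental x y z HIJ HJK HKI) {i₁ i₂ : I} (hne : i₁ ≠ i₂)
    {S₁ S₂ : Finset (I × J × K)} (hS₁ : ∀ τ ∈ S₁, IsTriangle HIJ HJK HKI τ ∧ τ.1 = i₁)
    (hS₂ : ∀ τ ∈ S₂, IsTriangle HIJ HJK HKI τ ∧ τ.1 = i₂) :
    S₁.card + S₂.card ≤ Fintype.card G := by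
  have hdisj : Disjoint S₁ S₂ := by
    rw [Finset.disjoint_left]
    intro τ h₁ h₂
    exact hne ((hS₁ τ h₁).2.symm.trans (hS₂ τ h₂).2)
  have hT : ∀ τ ∈ S₁ ∪ S₂, IsTriangle HIJ HJK HKI τ ∧ (τ.1 = i₁ ∨ τ.1 = i₂) := by
    intro τ hτ
    rcases Finset.mem_union.mp hτ with h | h
    · exact ⟨(hS₁ τ h).1, Or.inl (hS₁ τ h).2⟩
    · exact ⟨(hS₂ τ h).1, Or.inr (hS₂ τ h).2⟩
  -- the code of a triangle: its JK-label, shifted by `x i₂ - x i₁` when the triangle passes through `i₂` and its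
  -- JK-edge is also completed by `i₁`
  have hinj : Set.InjOn (fun τ : I × J × K =>
      if τ.1 = i₂ ∧ (i₁, τ.2.1, τ.2.2) ∈ triangleSet HIJ HJK HKI then y τ.2.1 - z τ.2.2 + (x i₂ - x i₁)
      else y τ.2.1 - z τ.2.2) ↑(S₁ ∪ S₂) := by
    rintro ⟨a, j, k⟩ hτ ⟨a', j', k'⟩ hτ' heq
    obtain ⟨ht, ha⟩ := hT _ (Finset.mem_coe.mp hτ)
    obtain ⟨ht', ha'⟩ := hT _ (Finset.mem_coe.mp hτ')
    simp only at heq ha ha'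
    obtain ⟨ht1, ht2, ht3⟩ := ht
    obtain ⟨ht1', ht2', ht3'⟩ := ht'
    simp only at ht1 ht2 ht3 ht1' ht2' ht3'
    have htri : IsTriangle HIJ HJK HKI (a, j, k) := ⟨ht1, ht2, ht3⟩
    have htri' : IsTriangle HIJ HJK HKI (a', j', k') := ⟨ht1', ht2', ht3'⟩
    split_ifs at heq with hc hc' hc''
    · -- both codes shifted: equal labels, both through `i₂`
      have hl : y j - z k = y j' - z k' := add_right_cancel heq
      have h2 := hN.edgeJK_eq_of_label_eq htri htri' hl
      simp only [Prod.mk.injEq] at h2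
      rw [hc.1, hc'.1, h2.1, h2.2]
    · -- shifted = plain: impossible
      exfalso
      have h1 : (i₁, j) ∈ HIJ := (mem_triangleSet.mp hc.2).1
      have h3 : (k, i₂) ∈ HKI := hc.1 ▸ ht3
      exact hN.shifted_label_ne hne h1 h3 ht2' heq
    · -- plain = shifted: impossible
      exfalso
      have h1 : (i₁, j') ∈ HIJ := (mem_triangleSet.mp hc''.2).1
      have h3 : (k', i₂) ∈ HKI := hc''.1 ▸ ht3'
      exact hN.shifted_label_ne hne h1 h3 ht2 heq.symm
    · -- both plain: equal JK-edges; equal I-vertices unless one of the codes should have been shifted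
      have h2 := hN.edgeJK_eq_of_label_eq htri htri' heq
      simp only [Prod.mk.injEq] at h2
      obtain ⟨hj, hk⟩ := h2
      subst hj hk
      rcases ha with ha | ha <;> rcases ha' with ha' | ha'
      · rw [ha, ha']
      · exfalso
        apply hc''
        refine ⟨ha', ?_⟩
        rw [mem_triangleSet, ← ha]
        exact htri
      · exfalso
        apply hc
        refine ⟨ha, ?_⟩
        rw [mem_triangleSet, ← ha']
        exact htri'
      · rw [ha, ha']
  rw [← Finset.card_union_of_disjoint hdisj, ← Finset.card_image_of_injOn hinj]
  exact Finset.card_le_univ _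

/-- `t_{i₁} + t_{i₂} ≤ |G|`: the triangle degrees of two distinct `I`-vertices of a finite configuration sum to at
most `|G|`. -/
theorem NoAccidental.degree_add_degree_le [Fintype G] [DecidableEq G] [DecidableEq I] [DecidableEq J]
    [DecidableEq K] (hN : NoAccidental x y z HIJ HJK HKI) {i₁ i₂ : I} (hne : i₁ ≠ i₂) :
    ((triangleSet HIJ HJK HKI).filter (fun τ => τ.1 = i₁)).card
      + ((triangleSet HIJ HJK HKI).filter (fun τ => τ.1 = i₂)).card ≤ Fintype.card G := by
  refine hN.card_link_add_card_link_le hne ?_ ?_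
  · intro τ hτ
    rw [Finset.mem_filter, mem_triangleSet] at hτ
    exact hτ
  · intro τ hτ
    rw [Finset.mem_filter, mem_triangleSet] at hτ
    exact hτ

/-- The perfect block of `SoloInformedValVertexDegree`'s counterexample group is not needed here; as a sanity
check of tightness in the smallest case we record the two-row block in `(ℤ/2)⁴`:
`I = Fin 2` (potentials `0000, 1000`), `J = Fin 2` (`0000, 0100`), `K = Fin 4` (`0000, 0010, 0001, 0011`), all
pair graphs complete — `16 = |G|` triangles, `8 + 8 = 16` through the two `I`-vertices. -/
def pbX : Fin 2 → G16 := ![(0, 0, 0, 0), (1, 0, 0, 0)]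

/-- `J`-potentials of the two-row block. -/
def pbY : Fin 2 → G16 := ![(0, 0, 0, 0), (0, 1, 0, 0)]

/-- `K`-potentials of the two-row block. -/
def pbZ : Fin 4 → G16 := ![(0, 0, 0, 0), (0, 0, 1, 0), (0, 0, 0, 1), (0, 0, 1, 1)]

/-- The two-row block in `(ℤ/2)⁴` has no accidental solutions. -/
theorem pb_noAccidental :
    NoAccidental pbX pbY pbZ (Finset.univ : Finset (Fin 2 × Fin 2)) (Finset.univ : Finset (Fin 2 × Fin 4))
      (Finset.univ : Finset (Fin 4 × Fin 2)) := by
  unfold NoAccidental pbX pbY pbZ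
  decide

/-- TIGHTNESS of pair packing: the two `I`-vertices of the two-row block carry `8 + 8 = 16 = |G|` triangles. -/
theorem pb_degrees :
    ((triangleSet (Finset.univ : Finset (Fin 2 × Fin 2)) (Finset.univ : Finset (Fin 2 × Fin 4))
        (Finset.univ : Finset (Fin 4 × Fin 2))).filter (fun τ => τ.1 = 0)).card
      + ((triangleSet (Finset.univ : Finset (Fin 2 × Fin 2)) (Finset.univ : Finset (Fin 2 × Fin 4))
        (Finset.univ : Finset (Fin 4 × Fin 2))).filter (fun τ => τ.1 = 1)).card = Fintype.card G16 := by
  rw [card_G16]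
  decide

end Summit.MatrixMultiplication.MatrixMultiplication.Theorems.SoloVal
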